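import Summits.QuantumFields.YangMills.Theorems.FluctuationComparisonRegPrIntLS2BetaKappaRatioTower
import Summits.QuantumFields.YangMills.Theorems.FluctuationComparisonRegPrIntLS2BetaBlockPairReadCover
import Summits.QuantumFields.YangMills.Theorems.FluctuationComparisonRegPrIntLS2BetaGeodesicJensenLift
import HarnessLib

/-!
# S2β · W-ρκ FILE δ — THE δC-COLUMN DOCK: ✓p835991 `hκrel_of_textLetters`'s binder `hδT` holds at `δC t B :=` the Pi-sup of the station's relative log field over
# the block-pair read BOX of ✓p836161, and `Σ_B δC(t,B)² ≤ (2·d·7^d)·E′lam t` (pure transport over the tree; no letter, no hypothesis beyond the data)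

Cell `ym3-torus` (rung R3 = continuum `SU(2)` YM₃ on T³ at fixed lattice data — NOT d = 4, NOT infinite volume, NOT a mass gap, NOT Clay).  Width seat
`ym3-torus-px16` (gen 24); crux `stmt-QuantumFields-20520` `FluctuationComparisonRegPrIntL`, LINE g18-1 S2β (registry `Lines/semiclassical_s2beta.lean` 3732b7df
UNTOUCHED); organ GAP♯∘ ⟸ … ⟸ LIFT-LADDER rows + D′-budget split; `hDisc` = px20 g24's ✓p835795 `discRow'`, whose `hκrel` is ✓p835991 `hκrel_of_textLetters` (this seat)
from region letters `hρT` (c₁ CELL-MASS object), `hδT` (relative chords over the block-pair boxes), plaquette classes.  ARCHITECT RULING «ρκ-CURL» debts: (k1) ρP column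
(px10 g26), (k2) the block-pair read cover ✓p836161 (px21 g25), (k3) partner plaquettes (w4 g28).  THIS FILE closes the δC side of (k2) at the tower: with
**`δC t B := ‖(fun ℓ′ => if BOX_t(B)(ℓ′) then logVec (su2Quat (D_{J+t+1,K}(e^ζU₀) ℓ′ · (D_{J+t+1,K}U₀ ℓ′)⁻¹)) else 0)‖`** (`BOX_t(B)` = ✓p836161's text VERBATIM: a
`READ′_t(B)` bond `ℓ″` and `blockOf ℓ′.src ∈ {blockOf ℓ″.src − e_dir, blockOf ℓ″.src, blockOf ℓ″.src + e_dir}`; the inner field = the station's `E′lam` integrand VERBATIM),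
§1 ★★★`hδT_of_boxSup`: the `hδT` binder of `hκrel_of_textLetters` HOLDS (conclusion = its text at this `δC`) — `e ↦ σ₂⁻¹e` (`bondShift` is an `Equiv`),
`Ū^sU (σ₂ℓ′) = D_{J+t+1,K}U ℓ′` (✓`descendTo_apply_eq_iter`, `rfl`), `dist1 (X₀⁻¹X) = dist1 (XX₀⁻¹) ≤ ‖logVec (su2Quat (XX₀⁻¹))‖` (✓`dist1_mul_inv_eq_rel`,
✓`dist1_le_norm_logVec`), `norm_le_pi_norm`, and the box transport `blockOf (σ₂x) = σ(blockOf x)`, `σ(y ± e_μ) = σy ± e_μ` (lit ✓`siteShift_blockOf`∕`_shift`∕`_unshift`);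
§2 ★★`sum_sq_deltaC_le`: **`Σ_B δC(t,B)² ≤ ((2·(F.P J).d·7^(F.P J).d : ℕ) : ℝ)·E′lam t`** (= ✓p836161 `sum_sq_boxSup_le_readSup J t f` at this `f`; `E′lam` text VERBATIM);
§3 ★★★`hρκ_of_columns`: (α)'s `hρκ` binder (px21 g25 `hR_of_columns`) from a ρP-column budget ((k1)) + §2: `Σ_t L^t·Σ_B ρκ(t,B)² ≤ (2(3K)²C_P)·e^{cΣθ′}·purse +
(2(3K)²β_P + 2(3K·2(ℓ+2)ā′)²·(2d·7^d))·S′` with `ρκ t B := 3·(K·(ρP t B + 2·a′ t·((ℓ+2)·δC t B)))` UNFOLDED at this `δC` (purse ∕ Σθ′ ∕ S′ texts VERBATIM from ✓`hX'_of_rColumn`).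
So in (α)∕knit the `a′²·δC²` column of ✓`sq_rhoKappa_le` is an `S′`-share by `exact`, and γ §3's `hδT` leaves the hypothesis list.
`--kind proof --supports stmt-QuantumFields-20520 --as helper`, count-neutral, DEFINITION-FREE (0 `def`, 0 `instance`, 0 `sorry`; default heartbeats).

HONEST.  Transport∕bookkeeping over landed lemmas; nothing of Bałaban's renormalisation-group analysis is asserted or proved; the other columns ((k1) ρP, ρ̃, m), (k3), every
budget, (ST)∕LOC, `h3` are HYPOTHESES or other seats'; GAP♯∘ (`stub_uniformFibreGapOrbit`, registry 3732b7df UNTOUCHED, 0∕5), the five REGISTERED stubs, S2β, crux 20520,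
19936, 19200, `YM3TorusSU2` are NOT proved; no summit statement is proved by a helper; rung R3 = SU(2) YM₃ on T³ at fixed lattice data — NOT d = 4, NOT infinite volume,
NOT a mass gap, NOT Clay; the Yang–Mills mass gap is NOT proved.  Axioms standard.

References: T. Bałaban, CMP **99** (1985) 75–102 [Balaban1985RegularSpaces] ((1.19) p.79, (1.29) p.81); CMP **109** (1987) 249–301 [Balaban1987RG1] ((0.1)–(0.4), (0.11) pp.251–253);
CMP **98** (1985) 17–51 [Balaban1985Averaging] ((19)–(20) p.21).
-/

set_option autoImplicit false

namespace Summit.QuantumFields.YangMills.Theorems.FluctuationComparisonRegPrIntLS2BetaKappaRatioDeltaColumn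

open Literature.MathematicalPhysics.QuantumLattice (su2Quat)
open Literature.MathematicalPhysics.QuantumFieldTheory.Balaban1983to89
open T4Continuum T3ContinuumYM3Torus T3TiltDescent T3LevelShift BlockAveraging AveragingRT B10Eq47AxialChi
open B10Eq27TorusAxialLog (rel)
open T4CubeChartGnomonic (SU2)
open T4HaarSU2ExpChart (expPoint)
open T4ExpWindowSmallField (logVec)
open T3UnitLawDensityEML (ℰp)
open Summit.QuantumFields.YangMills.Theorems.FluctuationComparisonRegPrIntLS2BetaRelativeStokes (dist1_mul_inv_eq_rel)
open Summit.QuantumFields.YangMills.Theorems.FluctuationComparisonRegPrIntLS2BetaGeodesicJensenLift (dist1_le_norm_logVec)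
open Summit.QuantumFields.YangMills.Theorems.FluctuationComparisonRegPrIntLS2BetaLiftLadderCombRowTower (descendTo_apply_eq_iter)
open Summit.QuantumFields.YangMills.Theorems.FluctuationComparisonRegPrIntLS2BetaBlockPairReadCover (sum_sq_boxSup_le_readSup)

variable {F : T3Family}

/-! ## §1 The `hδT` binder at `δC := ‖𝟙[BOX]·η‖` -/

/-- ★★★ **✓`hκrel_of_textLetters`'s `hδT` HOLDS AT `δC t B := ‖𝟙[BOX_t(B)]·(relative log field of level J+t+1)‖`** (no hypothesis: the relative bond variable at a fine
bond `e` of height `s = K − (J+t+1)` in the block-pair box of a `READ′_t(B)` bond is, read back at level `J+t+1` through `σ₂⁻¹`, one value of the boxed field, whose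
`dist1` is at most the norm of its `logVec`, at most the Pi-sup). [cite: Balaban1987RG1, (0.1)-(0.4) pp.251-253, (0.11) p.253; Balaban1985RegularSpaces, (1.29) p.81] -/
theorem hδT_of_boxSup {J K : ℕ} (hJK : J ≤ K) (U₀ : GaugeField (F.P K) 0 (Matrix.specialUnitaryGroup (Fin 2) ℂ)) (ζ : PBond (F.P K) 0 → EuclideanSpace ℝ (Fin 3)) :
    ∀ (t : ℕ) (ht : t < K - J) (B : PBond (F.P J) 0) (e : PBond (F.P K) (K - (J + (t + 1)))),
      (∃ ℓ' : PBond (F.P (J + (t + 1))) 0, (∃ z : Site (F.P (J + (t + 1))) 0,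
                (B14.Eq22Determines.blockIter (t + 1) z = (bondShift (F.sitesPerDir_eq (m := F.m) (K := J) (j := 0) (m' := F.m) (K' := J + (t + 1)) (j' := t + 1) (by omega)) B).src ∨ B14.Eq22Determines.blockIter (t + 1) z = (bondShift (F.sitesPerDir_eq (m := F.m) (K := J) (j := 0) (m' := F.m) (K' := J + (t + 1)) (j' := t + 1) (by omega)) B).tgt) ∧
                ∀ ν, (B10Eq27TorusAxialLog.rel z ℓ'.src ν).natAbs ≤ 2) ∧
        (blockOf e.src = (blockOf (bondShift (F.sitesPerDir_eq (m := F.m) (K := J + (t + 1)) (j := 0) (m' := F.m) (K' := K) (j' := (K - (J + (t + 1)))) (by omega)) ℓ').src).unshift (bondShift (F.sitesPerDir_eq (m := F.m) (K := J + (t + 1)) (j := 0) (m' := F.m) (K' := K) (j' := (K - (J + (t + 1)))) (by omega)) ℓ').dir ∨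
          blockOf e.src = blockOf (bondShift (F.sitesPerDir_eq (m := F.m) (K := J + (t + 1)) (j := 0) (m' := F.m) (K' := K) (j' := (K - (J + (t + 1)))) (by omega)) ℓ').src ∨
          blockOf e.src = (blockOf (bondShift (F.sitesPerDir_eq (m := F.m) (K := J + (t + 1)) (j := 0) (m' := F.m) (K' := K) (j' := (K - (J + (t + 1)))) (by omega)) ℓ').src).shift (bondShift (F.sitesPerDir_eq (m := F.m) (K := J + (t + 1)) (j := 0) (m' := F.m) (K' := K) (j' := (K - (J + (t + 1)))) (by omega)) ℓ').dir)) →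
      dist1 ((Averaging.iter (fun k => blockAvg (P := F.P K) (j := k) ℰp) (K - (J + (t + 1))) U₀ e)⁻¹ *
        Averaging.iter (fun k => blockAvg (P := F.P K) (j := k) ℰp) (K - (J + (t + 1))) (fun ℓ => expPoint (ζ ℓ) * U₀ ℓ) e) ≤
        (fun (t : ℕ) (B : PBond (F.P J) 0) => if ht : t < K - J then ‖(fun ℓ' : PBond (F.P (J + (t + 1))) 0 =>
        if (∃ ℓ'' : PBond (F.P (J + (t + 1))) 0, (∃ z : Site (F.P (J + (t + 1))) 0,
                (B14.Eq22Determines.blockIter (t + 1) z = (bondShift (F.sitesPerDir_eq (m := F.m) (K := J) (j := 0) (m' := F.m) (K' := J + (t + 1)) (j' := t + 1) (by omega)) B).src ∨ B14.Eq22Determines.blockIter (t + 1) z = (bondShift (F.sitesPerDir_eq (m := F.m) (K := J) (j := 0) (m' := F.m) (K' := J + (t + 1)) (j' := t + 1) (by omega)) B).tgt) ∧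
                ∀ ν, (B10Eq27TorusAxialLog.rel z ℓ''.src ν).natAbs ≤ 2) ∧
                (blockOf ℓ'.src = (blockOf ℓ''.src).unshift ℓ''.dir ∨ blockOf ℓ'.src = blockOf ℓ''.src ∨ blockOf ℓ'.src = (blockOf ℓ''.src).shift ℓ''.dir))
        then logVec (su2Quat (descendTo F ℰp (J + (t + 1)) K (by omega) (fun ℓ => expPoint (ζ ℓ) * U₀ ℓ : GaugeField (F.P K) 0 (Matrix.specialUnitaryGroup (Fin 2) ℂ)) ℓ' * (descendTo F ℰp (J + (t + 1)) K (by omega) U₀ ℓ')⁻¹)) else 0)‖ else 0) t B := by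
  have _h := hJK
  intro t ht B e he
  obtain ⟨ℓ', hread, hbox⟩ := he
  beta_reduce
  rw [dif_pos ht]
  -- read `e` back at level `J+t+1`
  set P₂ := F.sitesPerDir_eq (m := F.m) (K := J + (t + 1)) (j := 0) (m' := F.m) (K' := K) (j' := (K - (J + (t + 1)))) (by omega) with hP₂
  set ℓ₁ : PBond (F.P (J + (t + 1))) 0 := (bondShift P₂).symm e with hℓ₁
  have he₁ : e = bondShift P₂ ℓ₁ := ((bondShift P₂).apply_symm_apply e).symm
  -- the box membership of `ℓ₁` at level `J+t+1`
  have Q₂ : (F.P (J + (t + 1))).sitesPerDir (0 + 1) = (F.P K).sitesPerDir ((K - (J + (t + 1))) + 1) := F.sitesPerDir_eq (by omega)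
  have hsrc₁ : e.src = siteShift P₂ ℓ₁.src := by rw [he₁]; rfl
  have hsrc' : (bondShift P₂ ℓ').src = siteShift P₂ ℓ'.src := rfl
  have hdir' : (bondShift P₂ ℓ').dir = ℓ'.dir := rfl
  have hblk₁ : blockOf e.src = siteShift Q₂ (blockOf ℓ₁.src) := by rw [hsrc₁]; exact (siteShift_blockOf P₂ Q₂ ℓ₁.src).symm
  have hblk' : blockOf (bondShift P₂ ℓ').src = siteShift Q₂ (blockOf ℓ'.src) := by rw [hsrc']; exact (siteShift_blockOf P₂ Q₂ ℓ'.src).symm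
  have hbox₁ : blockOf ℓ₁.src = (blockOf ℓ'.src).unshift ℓ'.dir ∨ blockOf ℓ₁.src = blockOf ℓ'.src ∨ blockOf ℓ₁.src = (blockOf ℓ'.src).shift ℓ'.dir := by
    rw [hblk₁, hblk', hdir'] at hbox
    rcases hbox with h | h | h
    · left; exact (siteShift Q₂).injective (h.trans (siteShift_unshift Q₂ _ _).symm)
    · right; left; exact (siteShift Q₂).injective h
    · right; right; exact (siteShift Q₂).injective (h.trans (siteShift_shift Q₂ _ _).symm)
  have hmem : ∃ ℓ'' : PBond (F.P (J + (t + 1))) 0, (∃ z : Site (F.P (J + (t + 1))) 0,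
                (B14.Eq22Determines.blockIter (t + 1) z = (bondShift (F.sitesPerDir_eq (m := F.m) (K := J) (j := 0) (m' := F.m) (K' := J + (t + 1)) (j' := t + 1) (by omega)) B).src ∨ B14.Eq22Determines.blockIter (t + 1) z = (bondShift (F.sitesPerDir_eq (m := F.m) (K := J) (j := 0) (m' := F.m) (K' := J + (t + 1)) (j' := t + 1) (by omega)) B).tgt) ∧
                ∀ ν, (B10Eq27TorusAxialLog.rel z ℓ''.src ν).natAbs ≤ 2) ∧
                (blockOf ℓ₁.src = (blockOf ℓ''.src).unshift ℓ''.dir ∨ blockOf ℓ₁.src = blockOf ℓ''.src ∨ blockOf ℓ₁.src = (blockOf ℓ''.src).shift ℓ''.dir) :=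
    ⟨ℓ', hread, hbox₁⟩
  -- the stage fields at `e` are the descended fields at `ℓ₁`
  have hU₀e : Averaging.iter (fun k => blockAvg (P := F.P K) (j := k) ℰp) (K - (J + (t + 1))) U₀ e =
      descendTo F ℰp (J + (t + 1)) K (by omega) U₀ ℓ₁ := by rw [he₁, descendTo_apply_eq_iter]
  have hU'e : Averaging.iter (fun k => blockAvg (P := F.P K) (j := k) ℰp) (K - (J + (t + 1))) (fun ℓ => expPoint (ζ ℓ) * U₀ ℓ) e =
      descendTo F ℰp (J + (t + 1)) K (by omega) (fun ℓ => expPoint (ζ ℓ) * U₀ ℓ : GaugeField (F.P K) 0 (Matrix.specialUnitaryGroup (Fin 2) ℂ)) ℓ₁ := by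
    rw [he₁, descendTo_apply_eq_iter]
  rw [hU₀e, hU'e, ← dist1_mul_inv_eq_rel]
  refine (dist1_le_norm_logVec _).trans ?_
  have hpi := norm_le_pi_norm (fun ℓ' : PBond (F.P (J + (t + 1))) 0 =>
        if (∃ ℓ'' : PBond (F.P (J + (t + 1))) 0, (∃ z : Site (F.P (J + (t + 1))) 0,
                (B14.Eq22Determines.blockIter (t + 1) z = (bondShift (F.sitesPerDir_eq (m := F.m) (K := J) (j := 0) (m' := F.m) (K' := J + (t + 1)) (j' := t + 1) (by omega)) B).src ∨ B14.Eq22Determines.blockIter (t + 1) z = (bondShift (F.sitesPerDir_eq (m := F.m) (K := J) (j := 0) (m' := F.m) (K' := J + (t + 1)) (j' := t + 1) (by omega)) B).tgt) ∧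
                ∀ ν, (B10Eq27TorusAxialLog.rel z ℓ''.src ν).natAbs ≤ 2) ∧
                (blockOf ℓ'.src = (blockOf ℓ''.src).unshift ℓ''.dir ∨ blockOf ℓ'.src = blockOf ℓ''.src ∨ blockOf ℓ'.src = (blockOf ℓ''.src).shift ℓ''.dir))
        then logVec (su2Quat (descendTo F ℰp (J + (t + 1)) K (by omega) (fun ℓ => expPoint (ζ ℓ) * U₀ ℓ : GaugeField (F.P K) 0 (Matrix.specialUnitaryGroup (Fin 2) ℂ)) ℓ' * (descendTo F ℰp (J + (t + 1)) K (by omega) U₀ ℓ')⁻¹)) else 0) ℓ₁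
  rw [if_pos hmem] at hpi
  exact hpi

/-! ## §2 The column budget: `Σ_B δC(t,B)² ≤ (2·d·7^d)·E′lam t` -/

/-- ★★ **THE δC COLUMN IS AN `E′`-SHARE**: `Σ_B δC(t,B)² ≤ ((2·(F.P J).d·7^(F.P J).d : ℕ) : ℝ)·E′lam t`, `E′lam t` the stations' READ′ energy VERBATIM
(✓p836161 `sum_sq_boxSup_le_readSup` at the relative log field). [cite: Balaban1985RegularSpaces, (1.29) p.81; Balaban1987RG1, (0.11) p.253] -/
theorem sum_sq_deltaC_le {J K : ℕ} (hJK : J ≤ K) (U₀ : GaugeField (F.P K) 0 (Matrix.specialUnitaryGroup (Fin 2) ℂ)) (ζ : PBond (F.P K) 0 → EuclideanSpace ℝ (Fin 3))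
    (t : ℕ) (ht : t < K - J) :
    ∑ B : PBond (F.P J) 0, ((fun (t : ℕ) (B : PBond (F.P J) 0) => if ht : t < K - J then ‖(fun ℓ' : PBond (F.P (J + (t + 1))) 0 =>
        if (∃ ℓ'' : PBond (F.P (J + (t + 1))) 0, (∃ z : Site (F.P (J + (t + 1))) 0,
                (B14.Eq22Determines.blockIter (t + 1) z = (bondShift (F.sitesPerDir_eq (m := F.m) (K := J) (j := 0) (m' := F.m) (K' := J + (t + 1)) (j' := t + 1) (by omega)) B).src ∨ B14.Eq22Determines.blockIter (t + 1) z = (bondShift (F.sitesPerDir_eq (m := F.m) (K := J) (j := 0) (m' := F.m) (K' := J + (t + 1)) (j' := t + 1) (by omega)) B).tgt) ∧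
                ∀ ν, (B10Eq27TorusAxialLog.rel z ℓ''.src ν).natAbs ≤ 2) ∧
                (blockOf ℓ'.src = (blockOf ℓ''.src).unshift ℓ''.dir ∨ blockOf ℓ'.src = blockOf ℓ''.src ∨ blockOf ℓ'.src = (blockOf ℓ''.src).shift ℓ''.dir))
        then logVec (su2Quat (descendTo F ℰp (J + (t + 1)) K (by omega) (fun ℓ => expPoint (ζ ℓ) * U₀ ℓ : GaugeField (F.P K) 0 (Matrix.specialUnitaryGroup (Fin 2) ℂ)) ℓ' * (descendTo F ℰp (J + (t + 1)) K (by omega) U₀ ℓ')⁻¹)) else 0)‖ else 0) t B) ^ 2 ≤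
      ((2 * (F.P J).d * 7 ^ (F.P J).d : ℕ) : ℝ) * ∑ B : PBond (F.P J) 0, ‖(fun ℓ' : PBond (F.P (J + (t + 1))) 0 =>
        if ∃ z : Site (F.P (J + (t + 1))) 0,
                (B14.Eq22Determines.blockIter (t + 1) z = (bondShift (F.sitesPerDir_eq (m := F.m) (K := J) (j := 0) (m' := F.m) (K' := J + (t + 1)) (j' := t + 1) (by omega)) B).src ∨ B14.Eq22Determines.blockIter (t + 1) z = (bondShift (F.sitesPerDir_eq (m := F.m) (K := J) (j := 0) (m' := F.m) (K' := J + (t + 1)) (j' := t + 1) (by omega)) B).tgt) ∧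
                ∀ ν, (B10Eq27TorusAxialLog.rel z ℓ'.src ν).natAbs ≤ 2
        then logVec (su2Quat (descendTo F ℰp (J + (t + 1)) K (by omega) (fun ℓ => expPoint (ζ ℓ) * U₀ ℓ : GaugeField (F.P K) 0 (Matrix.specialUnitaryGroup (Fin 2) ℂ)) ℓ' * (descendTo F ℰp (J + (t + 1)) K (by omega) U₀ ℓ')⁻¹)) else 0)‖ ^ 2 := by
  have _h := hJK
  simp only [dif_pos ht]
  exact sum_sq_boxSup_le_readSup J t (fun ℓ' : PBond (F.P (J + (t + 1))) 0 => logVec (su2Quat (descendTo F ℰp (J + (t + 1)) K (by omega) (fun ℓ => expPoint (ζ ℓ) * U₀ ℓ : GaugeField (F.P K) 0 (Matrix.specialUnitaryGroup (Fin 2) ℂ)) ℓ' * (descendTo F ℰp (J + (t + 1)) K (by omega) U₀ ℓ')⁻¹)))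


/-! ## §3 The ρκ-COLUMN BUDGET from the ρP-column budget ((k1)) and §2 -/

/-- For `t < K − J` the inner `S′` summand is `L^t·E′lam t`. [folklore] -/
private theorem sPrime_summand_eq {J K : ℕ} (U₀ : GaugeField (F.P K) 0 (Matrix.specialUnitaryGroup (Fin 2) ℂ)) (ζ : PBond (F.P K) 0 → EuclideanSpace ℝ (Fin 3))
    (t : ℕ) (ht : t < K - J) :
    (if ht : t < K - J then
          (F.L : ℝ) ^ t * ∑ B : PBond (F.P J) 0,
            ‖(fun ℓ' : PBond (F.P (J + (t + 1))) 0 =>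
              if ∃ z : Site (F.P (J + (t + 1))) 0,
                (B14.Eq22Determines.blockIter (t + 1) z = (bondShift (F.sitesPerDir_eq (m := F.m) (K := J) (j := 0) (m' := F.m) (K' := J + (t + 1)) (j' := t + 1) (by omega)) B).src ∨ B14.Eq22Determines.blockIter (t + 1) z = (bondShift (F.sitesPerDir_eq (m := F.m) (K := J) (j := 0) (m' := F.m) (K' := J + (t + 1)) (j' := t + 1) (by omega)) B).tgt) ∧
                ∀ ν, (B10Eq27TorusAxialLog.rel z ℓ'.src ν).natAbs ≤ 2
              then logVec (su2Quat (descendTo F ℰp (J + (t + 1)) K (by omega) (fun ℓ => expPoint (ζ ℓ) * U₀ ℓ : GaugeField (F.P K) 0 (Matrix.specialUnitaryGroup (Fin 2) ℂ)) ℓ' * (descendTo F ℰp (J + (t + 1)) K (by omega) U₀ ℓ')⁻¹)) else 0)‖ ^ 2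
        else 0) = (F.L : ℝ) ^ t * ∑ B : PBond (F.P J) 0,
            ‖(fun ℓ' : PBond (F.P (J + (t + 1))) 0 =>
              if ∃ z : Site (F.P (J + (t + 1))) 0,
                (B14.Eq22Determines.blockIter (t + 1) z = (bondShift (F.sitesPerDir_eq (m := F.m) (K := J) (j := 0) (m' := F.m) (K' := J + (t + 1)) (j' := t + 1) (by omega)) B).src ∨ B14.Eq22Determines.blockIter (t + 1) z = (bondShift (F.sitesPerDir_eq (m := F.m) (K := J) (j := 0) (m' := F.m) (K' := J + (t + 1)) (j' := t + 1) (by omega)) B).tgt) ∧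
                ∀ ν, (B10Eq27TorusAxialLog.rel z ℓ'.src ν).natAbs ≤ 2
              then logVec (su2Quat (descendTo F ℰp (J + (t + 1)) K (by omega) (fun ℓ => expPoint (ζ ℓ) * U₀ ℓ : GaugeField (F.P K) 0 (Matrix.specialUnitaryGroup (Fin 2) ℂ)) ℓ' * (descendTo F ℰp (J + (t + 1)) K (by omega) U₀ ℓ')⁻¹)) else 0)‖ ^ 2 := by
  rw [dif_pos ht]

set_option maxHeartbeats 400000 in
/-- ★★★ **THE ρκ-COLUMN BUDGET** ((α)'s `hρκ` binder currency, px21 g25 `hR_of_columns`): with `ρκ t B := 3·(K·(ρP t B + 2·a′ t·((ℓ+2)·δC t B)))`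
(✓p835991) and `δC` of §1, a ρP-column budget `Σ_t L^t·Σ_B ρP(t,B)² ≤ C_P·e^{cΣθ′}·purse + β_P·S′` ((k1), px10 g26's CELL-MASS object at `θr = 2L+1`) and
`a′ t ≤ ā′` give **`Σ_{t<K−J} L^t·Σ_B ρκ(t,B)² ≤ (2(3K)²·C_P)·e^{cΣθ′}·purse + (2(3K)²·β_P + 2(3K·(2(ℓ+2)·ā′))²·(2d·7^d))·S′`** (§2 per level, ✓`sq_rhoKappa_le`,
the `S′` summands collected). [cite: Balaban1985RegularSpaces, (1.29) p.81; Balaban1987RG1, (0.4), (0.11) p.253] -/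
theorem hρκ_of_columns {J K : ℕ} (hJK : J ≤ K) (U₀ : GaugeField (F.P K) 0 (Matrix.specialUnitaryGroup (Fin 2) ℂ)) (ζ : PBond (F.P K) 0 → EuclideanSpace ℝ (Fin 3))
    (θ : ℕ → ℝ) (ρP : ℕ → PBond (F.P J) 0 → ℝ) (a' : ℕ → ℝ) {ā' : ℝ} (ha0' : ∀ t, 0 ≤ a' t)
    (ha' : ∀ t, t < K - J → a' t ≤ ā') {C_P β_P c : ℝ}
    (hP : ∑ t ∈ Finset.range (K - J), (F.L : ℝ) ^ t * ∑ B : PBond (F.P J) 0, ρP t B ^ 2 ≤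
      C_P * Real.exp (c * ∑ i ∈ Finset.range (K - J), (((5 * F.L : ℕ) : ℝ) ^ 2 / 4) * θ (K - i)) * (((F.L : ℝ)⁻¹) ^ (K - J) * ∑ ℓ : PBond (F.P K) 0, ‖ζ ℓ‖ ^ 2 +
                (F.L : ℝ) ^ (K - J) * ∑ p : Plaq (F.P K) 0,
                  (1 - reTr ((GaugeField.plaqHol U₀ p)⁻¹ * GaugeField.plaqHol (fun ℓ => expPoint (ζ ℓ) * U₀ ℓ : GaugeField (F.P K) 0 (Matrix.specialUnitaryGroup (Fin 2) ℂ)) p))) + β_P * (∑ t ∈ Finset.range (K - J), (if ht : t < K - J then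
          (F.L : ℝ) ^ t * ∑ B : PBond (F.P J) 0,
            ‖(fun ℓ' : PBond (F.P (J + (t + 1))) 0 =>
              if ∃ z : Site (F.P (J + (t + 1))) 0,
                (B14.Eq22Determines.blockIter (t + 1) z = (bondShift (F.sitesPerDir_eq (m := F.m) (K := J) (j := 0) (m' := F.m) (K' := J + (t + 1)) (j' := t + 1) (by omega)) B).src ∨ B14.Eq22Determines.blockIter (t + 1) z = (bondShift (F.sitesPerDir_eq (m := F.m) (K := J) (j := 0) (m' := F.m) (K' := J + (t + 1)) (j' := t + 1) (by omega)) B).tgt) ∧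
                ∀ ν, (B10Eq27TorusAxialLog.rel z ℓ'.src ν).natAbs ≤ 2
              then logVec (su2Quat (descendTo F ℰp (J + (t + 1)) K (by omega) (fun ℓ => expPoint (ζ ℓ) * U₀ ℓ : GaugeField (F.P K) 0 (Matrix.specialUnitaryGroup (Fin 2) ℂ)) ℓ' * (descendTo F ℰp (J + (t + 1)) K (by omega) U₀ ℓ')⁻¹)) else 0)‖ ^ 2
        else 0))) :
    ∑ t ∈ Finset.range (K - J), (F.L : ℝ) ^ t * ∑ B : PBond (F.P J) 0,
        (3 * ((((((F.P K).d + 2) * (F.P K).L : ℕ) : ℝ) ^ 2 / 4) * (ρP t B + 2 * a' t * ((((((F.P K).d + 2) * (F.P K).L : ℕ) : ℝ) + 2) * (if ht : t < K - J then ‖(fun ℓ' : PBond (F.P (J + (t + 1))) 0 =>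
        if (∃ ℓ'' : PBond (F.P (J + (t + 1))) 0, (∃ z : Site (F.P (J + (t + 1))) 0,
                (B14.Eq22Determines.blockIter (t + 1) z = (bondShift (F.sitesPerDir_eq (m := F.m) (K := J) (j := 0) (m' := F.m) (K' := J + (t + 1)) (j' := t + 1) (by omega)) B).src ∨ B14.Eq22Determines.blockIter (t + 1) z = (bondShift (F.sitesPerDir_eq (m := F.m) (K := J) (j := 0) (m' := F.m) (K' := J + (t + 1)) (j' := t + 1) (by omega)) B).tgt) ∧
                ∀ ν, (B10Eq27TorusAxialLog.rel z ℓ''.src ν).natAbs ≤ 2) ∧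
                (blockOf ℓ'.src = (blockOf ℓ''.src).unshift ℓ''.dir ∨ blockOf ℓ'.src = blockOf ℓ''.src ∨ blockOf ℓ'.src = (blockOf ℓ''.src).shift ℓ''.dir))
        then logVec (su2Quat (descendTo F ℰp (J + (t + 1)) K (by omega) (fun ℓ => expPoint (ζ ℓ) * U₀ ℓ : GaugeField (F.P K) 0 (Matrix.specialUnitaryGroup (Fin 2) ℂ)) ℓ' * (descendTo F ℰp (J + (t + 1)) K (by omega) U₀ ℓ')⁻¹)) else 0)‖ else 0))))) ^ 2 ≤
      (2 * (3 * (((((F.P K).d + 2) * (F.P K).L : ℕ) : ℝ) ^ 2 / 4)) ^ 2 * C_P) * Real.exp (c * ∑ i ∈ Finset.range (K - J), (((5 * F.L : ℕ) : ℝ) ^ 2 / 4) * θ (K - i)) * (((F.L : ℝ)⁻¹) ^ (K - J) * ∑ ℓ : PBond (F.P K) 0, ‖ζ ℓ‖ ^ 2 +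
                (F.L : ℝ) ^ (K - J) * ∑ p : Plaq (F.P K) 0,
                  (1 - reTr ((GaugeField.plaqHol U₀ p)⁻¹ * GaugeField.plaqHol (fun ℓ => expPoint (ζ ℓ) * U₀ ℓ : GaugeField (F.P K) 0 (Matrix.specialUnitaryGroup (Fin 2) ℂ)) p))) +
      (2 * (3 * (((((F.P K).d + 2) * (F.P K).L : ℕ) : ℝ) ^ 2 / 4)) ^ 2 * β_P + 2 * (3 * (((((F.P K).d + 2) * (F.P K).L : ℕ) : ℝ) ^ 2 / 4) * (2 * (((((F.P K).d + 2) * (F.P K).L : ℕ) : ℝ) + 2) * ā')) ^ 2 * ((2 * (F.P J).d * 7 ^ (F.P J).d : ℕ) : ℝ)) * (∑ t ∈ Finset.range (K - J), (if ht : t < K - J then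
          (F.L : ℝ) ^ t * ∑ B : PBond (F.P J) 0,
            ‖(fun ℓ' : PBond (F.P (J + (t + 1))) 0 =>
              if ∃ z : Site (F.P (J + (t + 1))) 0,
                (B14.Eq22Determines.blockIter (t + 1) z = (bondShift (F.sitesPerDir_eq (m := F.m) (K := J) (j := 0) (m' := F.m) (K' := J + (t + 1)) (j' := t + 1) (by omega)) B).src ∨ B14.Eq22Determines.blockIter (t + 1) z = (bondShift (F.sitesPerDir_eq (m := F.m) (K := J) (j := 0) (m' := F.m) (K' := J + (t + 1)) (j' := t + 1) (by omega)) B).tgt) ∧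
                ∀ ν, (B10Eq27TorusAxialLog.rel z ℓ'.src ν).natAbs ≤ 2
              then logVec (su2Quat (descendTo F ℰp (J + (t + 1)) K (by omega) (fun ℓ => expPoint (ζ ℓ) * U₀ ℓ : GaugeField (F.P K) 0 (Matrix.specialUnitaryGroup (Fin 2) ℂ)) ℓ' * (descendTo F ℰp (J + (t + 1)) K (by omega) U₀ ℓ')⁻¹)) else 0)‖ ^ 2
        else 0)) := by
  -- names
  set Kc : ℝ := (((((F.P K).d + 2) * (F.P K).L : ℕ) : ℝ) ^ 2 / 4) with hKc
  set ℓ : ℝ := ((((F.P K).d + 2) * (F.P K).L : ℕ) : ℝ) with hℓ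
  set Cadj : ℝ := ((2 * (F.P J).d * 7 ^ (F.P J).d : ℕ) : ℝ) with hCadj
  set E : ℝ := Real.exp (c * ∑ i ∈ Finset.range (K - J), (((5 * F.L : ℕ) : ℝ) ^ 2 / 4) * θ (K - i)) with hE
  set Pu : ℝ := (((F.L : ℝ)⁻¹) ^ (K - J) * ∑ ℓ : PBond (F.P K) 0, ‖ζ ℓ‖ ^ 2 +
                (F.L : ℝ) ^ (K - J) * ∑ p : Plaq (F.P K) 0,
                  (1 - reTr ((GaugeField.plaqHol U₀ p)⁻¹ * GaugeField.plaqHol (fun ℓ => expPoint (ζ ℓ) * U₀ ℓ : GaugeField (F.P K) 0 (Matrix.specialUnitaryGroup (Fin 2) ℂ)) p))) with hPu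
  set EL : ℕ → ℝ := fun t => if ht : t < K - J then (F.L : ℝ) ^ t * ∑ B : PBond (F.P J) 0,
            ‖(fun ℓ' : PBond (F.P (J + (t + 1))) 0 =>
              if ∃ z : Site (F.P (J + (t + 1))) 0,
                (B14.Eq22Determines.blockIter (t + 1) z = (bondShift (F.sitesPerDir_eq (m := F.m) (K := J) (j := 0) (m' := F.m) (K' := J + (t + 1)) (j' := t + 1) (by omega)) B).src ∨ B14.Eq22Determines.blockIter (t + 1) z = (bondShift (F.sitesPerDir_eq (m := F.m) (K := J) (j := 0) (m' := F.m) (K' := J + (t + 1)) (j' := t + 1) (by omega)) B).tgt) ∧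
                ∀ ν, (B10Eq27TorusAxialLog.rel z ℓ'.src ν).natAbs ≤ 2
              then logVec (su2Quat (descendTo F ℰp (J + (t + 1)) K (by omega) (fun ℓ => expPoint (ζ ℓ) * U₀ ℓ : GaugeField (F.P K) 0 (Matrix.specialUnitaryGroup (Fin 2) ℂ)) ℓ' * (descendTo F ℰp (J + (t + 1)) K (by omega) U₀ ℓ')⁻¹)) else 0)‖ ^ 2 else 0 with hEL
  have hKc0 : 0 ≤ Kc := by positivity
  have hℓ0 : 0 ≤ ℓ := Nat.cast_nonneg _
  have hCadj0 : 0 ≤ Cadj := Nat.cast_nonneg _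
  have hL0 : 0 ≤ (F.L : ℝ) := Nat.cast_nonneg _
  -- per level
  have hlev : ∀ t ∈ Finset.range (K - J), (F.L : ℝ) ^ t * ∑ B : PBond (F.P J) 0,
        (3 * (Kc * (ρP t B + 2 * a' t * ((ℓ + 2) * (if ht : t < K - J then ‖(fun ℓ' : PBond (F.P (J + (t + 1))) 0 =>
        if (∃ ℓ'' : PBond (F.P (J + (t + 1))) 0, (∃ z : Site (F.P (J + (t + 1))) 0,
                (B14.Eq22Determines.blockIter (t + 1) z = (bondShift (F.sitesPerDir_eq (m := F.m) (K := J) (j := 0) (m' := F.m) (K' := J + (t + 1)) (j' := t + 1) (by omega)) B).src ∨ B14.Eq22Determines.blockIter (t + 1) z = (bondShift (F.sitesPerDir_eq (m := F.m) (K := J) (j := 0) (m' := F.m) (K' := J + (t + 1)) (j' := t + 1) (by omega)) B).tgt) ∧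
                ∀ ν, (B10Eq27TorusAxialLog.rel z ℓ''.src ν).natAbs ≤ 2) ∧
                (blockOf ℓ'.src = (blockOf ℓ''.src).unshift ℓ''.dir ∨ blockOf ℓ'.src = blockOf ℓ''.src ∨ blockOf ℓ'.src = (blockOf ℓ''.src).shift ℓ''.dir))
        then logVec (su2Quat (descendTo F ℰp (J + (t + 1)) K (by omega) (fun ℓ => expPoint (ζ ℓ) * U₀ ℓ : GaugeField (F.P K) 0 (Matrix.specialUnitaryGroup (Fin 2) ℂ)) ℓ' * (descendTo F ℰp (J + (t + 1)) K (by omega) U₀ ℓ')⁻¹)) else 0)‖ else 0))))) ^ 2 ≤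
      (2 * (3 * Kc) ^ 2) * ((F.L : ℝ) ^ t * ∑ B : PBond (F.P J) 0, ρP t B ^ 2) + (2 * (3 * Kc * (2 * (ℓ + 2) * ā')) ^ 2 * Cadj) * EL t := by
    intro t htm
    have ht : t < K - J := Finset.mem_range.mp htm
    have hā : 0 ≤ ā' := (ha0' t).trans (ha' t ht)
    have hsq := sum_sq_deltaC_le hJK U₀ ζ t ht
    simp only [dif_pos ht] at hsq ⊢
    -- pointwise split, then sum
    have hpt : ∀ B : PBond (F.P J) 0, (3 * (Kc * (ρP t B + 2 * a' t * ((ℓ + 2) * ‖(fun ℓ' : PBond (F.P (J + (t + 1))) 0 =>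
        if (∃ ℓ'' : PBond (F.P (J + (t + 1))) 0, (∃ z : Site (F.P (J + (t + 1))) 0,
                (B14.Eq22Determines.blockIter (t + 1) z = (bondShift (F.sitesPerDir_eq (m := F.m) (K := J) (j := 0) (m' := F.m) (K' := J + (t + 1)) (j' := t + 1) (by omega)) B).src ∨ B14.Eq22Determines.blockIter (t + 1) z = (bondShift (F.sitesPerDir_eq (m := F.m) (K := J) (j := 0) (m' := F.m) (K' := J + (t + 1)) (j' := t + 1) (by omega)) B).tgt) ∧
                ∀ ν, (B10Eq27TorusAxialLog.rel z ℓ''.src ν).natAbs ≤ 2) ∧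
                (blockOf ℓ'.src = (blockOf ℓ''.src).unshift ℓ''.dir ∨ blockOf ℓ'.src = blockOf ℓ''.src ∨ blockOf ℓ'.src = (blockOf ℓ''.src).shift ℓ''.dir))
        then logVec (su2Quat (descendTo F ℰp (J + (t + 1)) K (by omega) (fun ℓ => expPoint (ζ ℓ) * U₀ ℓ : GaugeField (F.P K) 0 (Matrix.specialUnitaryGroup (Fin 2) ℂ)) ℓ' * (descendTo F ℰp (J + (t + 1)) K (by omega) U₀ ℓ')⁻¹)) else 0)‖)))) ^ 2 ≤
        2 * (3 * Kc) ^ 2 * ρP t B ^ 2 + 2 * (3 * Kc * (2 * (ℓ + 2) * ā')) ^ 2 * ‖(fun ℓ' : PBond (F.P (J + (t + 1))) 0 =>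
        if (∃ ℓ'' : PBond (F.P (J + (t + 1))) 0, (∃ z : Site (F.P (J + (t + 1))) 0,
                (B14.Eq22Determines.blockIter (t + 1) z = (bondShift (F.sitesPerDir_eq (m := F.m) (K := J) (j := 0) (m' := F.m) (K' := J + (t + 1)) (j' := t + 1) (by omega)) B).src ∨ B14.Eq22Determines.blockIter (t + 1) z = (bondShift (F.sitesPerDir_eq (m := F.m) (K := J) (j := 0) (m' := F.m) (K' := J + (t + 1)) (j' := t + 1) (by omega)) B).tgt) ∧
                ∀ ν, (B10Eq27TorusAxialLog.rel z ℓ''.src ν).natAbs ≤ 2) ∧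
                (blockOf ℓ'.src = (blockOf ℓ''.src).unshift ℓ''.dir ∨ blockOf ℓ'.src = blockOf ℓ''.src ∨ blockOf ℓ'.src = (blockOf ℓ''.src).shift ℓ''.dir))
        then logVec (su2Quat (descendTo F ℰp (J + (t + 1)) K (by omega) (fun ℓ => expPoint (ζ ℓ) * U₀ ℓ : GaugeField (F.P K) 0 (Matrix.specialUnitaryGroup (Fin 2) ℂ)) ℓ' * (descendTo F ℰp (J + (t + 1)) K (by omega) U₀ ℓ')⁻¹)) else 0)‖ ^ 2 := by
      intro B
      refine (FluctuationComparisonRegPrIntLS2BetaKappaRatioTower.sq_rhoKappa_le _ _ _ _ _).trans ?_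
      have hn := norm_nonneg (fun ℓ' : PBond (F.P (J + (t + 1))) 0 =>
        if (∃ ℓ'' : PBond (F.P (J + (t + 1))) 0, (∃ z : Site (F.P (J + (t + 1))) 0,
                (B14.Eq22Determines.blockIter (t + 1) z = (bondShift (F.sitesPerDir_eq (m := F.m) (K := J) (j := 0) (m' := F.m) (K' := J + (t + 1)) (j' := t + 1) (by omega)) B).src ∨ B14.Eq22Determines.blockIter (t + 1) z = (bondShift (F.sitesPerDir_eq (m := F.m) (K := J) (j := 0) (m' := F.m) (K' := J + (t + 1)) (j' := t + 1) (by omega)) B).tgt) ∧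
                ∀ ν, (B10Eq27TorusAxialLog.rel z ℓ''.src ν).natAbs ≤ 2) ∧
                (blockOf ℓ'.src = (blockOf ℓ''.src).unshift ℓ''.dir ∨ blockOf ℓ'.src = blockOf ℓ''.src ∨ blockOf ℓ'.src = (blockOf ℓ''.src).shift ℓ''.dir))
        then logVec (su2Quat (descendTo F ℰp (J + (t + 1)) K (by omega) (fun ℓ => expPoint (ζ ℓ) * U₀ ℓ : GaugeField (F.P K) 0 (Matrix.specialUnitaryGroup (Fin 2) ℂ)) ℓ' * (descendTo F ℰp (J + (t + 1)) K (by omega) U₀ ℓ')⁻¹)) else 0)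
      have h1 : (3 * Kc * (2 * (ℓ + 2) * a' t)) ^ 2 ≤ (3 * Kc * (2 * (ℓ + 2) * ā')) ^ 2 := by
        apply pow_le_pow_left₀ (by have := ha0' t; positivity)
        exact mul_le_mul_of_nonneg_left (mul_le_mul_of_nonneg_left (ha' t ht) (by positivity)) (by positivity)
      nlinarith [sq_nonneg ‖(fun ℓ' : PBond (F.P (J + (t + 1))) 0 =>
        if (∃ ℓ'' : PBond (F.P (J + (t + 1))) 0, (∃ z : Site (F.P (J + (t + 1))) 0,
                (B14.Eq22Determines.blockIter (t + 1) z = (bondShift (F.sitesPerDir_eq (m := F.m) (K := J) (j := 0) (m' := F.m) (K' := J + (t + 1)) (j' := t + 1) (by omega)) B).src ∨ B14.Eq22Determines.blockIter (t + 1) z = (bondShift (F.sitesPerDir_eq (m := F.m) (K := J) (j := 0) (m' := F.m) (K' := J + (t + 1)) (j' := t + 1) (by omega)) B).tgt) ∧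
                ∀ ν, (B10Eq27TorusAxialLog.rel z ℓ''.src ν).natAbs ≤ 2) ∧
                (blockOf ℓ'.src = (blockOf ℓ''.src).unshift ℓ''.dir ∨ blockOf ℓ'.src = blockOf ℓ''.src ∨ blockOf ℓ'.src = (blockOf ℓ''.src).shift ℓ''.dir))
        then logVec (su2Quat (descendTo F ℰp (J + (t + 1)) K (by omega) (fun ℓ => expPoint (ζ ℓ) * U₀ ℓ : GaugeField (F.P K) 0 (Matrix.specialUnitaryGroup (Fin 2) ℂ)) ℓ' * (descendTo F ℰp (J + (t + 1)) K (by omega) U₀ ℓ')⁻¹)) else 0)‖, mul_le_mul_of_nonneg_right h1 (sq_nonneg ‖(fun ℓ' : PBond (F.P (J + (t + 1))) 0 =>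
        if (∃ ℓ'' : PBond (F.P (J + (t + 1))) 0, (∃ z : Site (F.P (J + (t + 1))) 0,
                (B14.Eq22Determines.blockIter (t + 1) z = (bondShift (F.sitesPerDir_eq (m := F.m) (K := J) (j := 0) (m' := F.m) (K' := J + (t + 1)) (j' := t + 1) (by omega)) B).src ∨ B14.Eq22Determines.blockIter (t + 1) z = (bondShift (F.sitesPerDir_eq (m := F.m) (K := J) (j := 0) (m' := F.m) (K' := J + (t + 1)) (j' := t + 1) (by omega)) B).tgt) ∧
                ∀ ν, (B10Eq27TorusAxialLog.rel z ℓ''.src ν).natAbs ≤ 2) ∧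
                (blockOf ℓ'.src = (blockOf ℓ''.src).unshift ℓ''.dir ∨ blockOf ℓ'.src = blockOf ℓ''.src ∨ blockOf ℓ'.src = (blockOf ℓ''.src).shift ℓ''.dir))
        then logVec (su2Quat (descendTo F ℰp (J + (t + 1)) K (by omega) (fun ℓ => expPoint (ζ ℓ) * U₀ ℓ : GaugeField (F.P K) 0 (Matrix.specialUnitaryGroup (Fin 2) ℂ)) ℓ' * (descendTo F ℰp (J + (t + 1)) K (by omega) U₀ ℓ')⁻¹)) else 0)‖)]
    have hsum := Finset.sum_le_sum fun B (_ : B ∈ (Finset.univ : Finset (PBond (F.P J) 0))) => hpt B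
    rw [Finset.sum_add_distrib, ← Finset.mul_sum, ← Finset.mul_sum] at hsum
    have hLt : 0 ≤ (F.L : ℝ) ^ t := pow_nonneg hL0 t
    have hc2 : 0 ≤ 2 * (3 * Kc * (2 * (ℓ + 2) * ā')) ^ 2 := by positivity
    have hEL' : EL t = (F.L : ℝ) ^ t * ∑ B : PBond (F.P J) 0,
            ‖(fun ℓ' : PBond (F.P (J + (t + 1))) 0 =>
              if ∃ z : Site (F.P (J + (t + 1))) 0,
                (B14.Eq22Determines.blockIter (t + 1) z = (bondShift (F.sitesPerDir_eq (m := F.m) (K := J) (j := 0) (m' := F.m) (K' := J + (t + 1)) (j' := t + 1) (by omega)) B).src ∨ B14.Eq22Determines.blockIter (t + 1) z = (bondShift (F.sitesPerDir_eq (m := F.m) (K := J) (j := 0) (m' := F.m) (K' := J + (t + 1)) (j' := t + 1) (by omega)) B).tgt) ∧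
                ∀ ν, (B10Eq27TorusAxialLog.rel z ℓ'.src ν).natAbs ≤ 2
              then logVec (su2Quat (descendTo F ℰp (J + (t + 1)) K (by omega) (fun ℓ => expPoint (ζ ℓ) * U₀ ℓ : GaugeField (F.P K) 0 (Matrix.specialUnitaryGroup (Fin 2) ℂ)) ℓ' * (descendTo F ℰp (J + (t + 1)) K (by omega) U₀ ℓ')⁻¹)) else 0)‖ ^ 2 := by rw [hEL]; exact sPrime_summand_eq U₀ ζ t ht
    rw [hEL']
    have hA := mul_le_mul_of_nonneg_left hsum hLt
    have hB := mul_le_mul_of_nonneg_left hsq (mul_nonneg hLt hc2)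
    have e1 : (F.L : ℝ) ^ t * (2 * (3 * Kc) ^ 2 * ∑ B : PBond (F.P J) 0, ρP t B ^ 2 +
        2 * (3 * Kc * (2 * (ℓ + 2) * ā')) ^ 2 * ∑ B : PBond (F.P J) 0, ‖(fun ℓ' : PBond (F.P (J + (t + 1))) 0 =>
        if (∃ ℓ'' : PBond (F.P (J + (t + 1))) 0, (∃ z : Site (F.P (J + (t + 1))) 0,
                (B14.Eq22Determines.blockIter (t + 1) z = (bondShift (F.sitesPerDir_eq (m := F.m) (K := J) (j := 0) (m' := F.m) (K' := J + (t + 1)) (j' := t + 1) (by omega)) B).src ∨ B14.Eq22Determines.blockIter (t + 1) z = (bondShift (F.sitesPerDir_eq (m := F.m) (K := J) (j := 0) (m' := F.m) (K' := J + (t + 1)) (j' := t + 1) (by omega)) B).tgt) ∧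
                ∀ ν, (B10Eq27TorusAxialLog.rel z ℓ''.src ν).natAbs ≤ 2) ∧
                (blockOf ℓ'.src = (blockOf ℓ''.src).unshift ℓ''.dir ∨ blockOf ℓ'.src = blockOf ℓ''.src ∨ blockOf ℓ'.src = (blockOf ℓ''.src).shift ℓ''.dir))
        then logVec (su2Quat (descendTo F ℰp (J + (t + 1)) K (by omega) (fun ℓ => expPoint (ζ ℓ) * U₀ ℓ : GaugeField (F.P K) 0 (Matrix.specialUnitaryGroup (Fin 2) ℂ)) ℓ' * (descendTo F ℰp (J + (t + 1)) K (by omega) U₀ ℓ')⁻¹)) else 0)‖ ^ 2) =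
        2 * (3 * Kc) ^ 2 * ((F.L : ℝ) ^ t * ∑ B : PBond (F.P J) 0, ρP t B ^ 2) +
        (F.L : ℝ) ^ t * (2 * (3 * Kc * (2 * (ℓ + 2) * ā')) ^ 2) * ∑ B : PBond (F.P J) 0, ‖(fun ℓ' : PBond (F.P (J + (t + 1))) 0 =>
        if (∃ ℓ'' : PBond (F.P (J + (t + 1))) 0, (∃ z : Site (F.P (J + (t + 1))) 0,
                (B14.Eq22Determines.blockIter (t + 1) z = (bondShift (F.sitesPerDir_eq (m := F.m) (K := J) (j := 0) (m' := F.m) (K' := J + (t + 1)) (j' := t + 1) (by omega)) B).src ∨ B14.Eq22Determines.blockIter (t + 1) z = (bondShift (F.sitesPerDir_eq (m := F.m) (K := J) (j := 0) (m' := F.m) (K' := J + (t + 1)) (j' := t + 1) (by omega)) B).tgt) ∧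
                ∀ ν, (B10Eq27TorusAxialLog.rel z ℓ''.src ν).natAbs ≤ 2) ∧
                (blockOf ℓ'.src = (blockOf ℓ''.src).unshift ℓ''.dir ∨ blockOf ℓ'.src = blockOf ℓ''.src ∨ blockOf ℓ'.src = (blockOf ℓ''.src).shift ℓ''.dir))
        then logVec (su2Quat (descendTo F ℰp (J + (t + 1)) K (by omega) (fun ℓ => expPoint (ζ ℓ) * U₀ ℓ : GaugeField (F.P K) 0 (Matrix.specialUnitaryGroup (Fin 2) ℂ)) ℓ' * (descendTo F ℰp (J + (t + 1)) K (by omega) U₀ ℓ')⁻¹)) else 0)‖ ^ 2 := by ring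
    rw [e1] at hA
    have e2 : (F.L : ℝ) ^ t * (2 * (3 * Kc * (2 * (ℓ + 2) * ā')) ^ 2) * (Cadj * ∑ B : PBond (F.P J) 0,
            ‖(fun ℓ' : PBond (F.P (J + (t + 1))) 0 =>
              if ∃ z : Site (F.P (J + (t + 1))) 0,
                (B14.Eq22Determines.blockIter (t + 1) z = (bondShift (F.sitesPerDir_eq (m := F.m) (K := J) (j := 0) (m' := F.m) (K' := J + (t + 1)) (j' := t + 1) (by omega)) B).src ∨ B14.Eq22Determines.blockIter (t + 1) z = (bondShift (F.sitesPerDir_eq (m := F.m) (K := J) (j := 0) (m' := F.m) (K' := J + (t + 1)) (j' := t + 1) (by omega)) B).tgt) ∧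
                ∀ ν, (B10Eq27TorusAxialLog.rel z ℓ'.src ν).natAbs ≤ 2
              then logVec (su2Quat (descendTo F ℰp (J + (t + 1)) K (by omega) (fun ℓ => expPoint (ζ ℓ) * U₀ ℓ : GaugeField (F.P K) 0 (Matrix.specialUnitaryGroup (Fin 2) ℂ)) ℓ' * (descendTo F ℰp (J + (t + 1)) K (by omega) U₀ ℓ')⁻¹)) else 0)‖ ^ 2) =
        2 * (3 * Kc * (2 * (ℓ + 2) * ā')) ^ 2 * Cadj * ((F.L : ℝ) ^ t * ∑ B : PBond (F.P J) 0,
            ‖(fun ℓ' : PBond (F.P (J + (t + 1))) 0 =>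
              if ∃ z : Site (F.P (J + (t + 1))) 0,
                (B14.Eq22Determines.blockIter (t + 1) z = (bondShift (F.sitesPerDir_eq (m := F.m) (K := J) (j := 0) (m' := F.m) (K' := J + (t + 1)) (j' := t + 1) (by omega)) B).src ∨ B14.Eq22Determines.blockIter (t + 1) z = (bondShift (F.sitesPerDir_eq (m := F.m) (K := J) (j := 0) (m' := F.m) (K' := J + (t + 1)) (j' := t + 1) (by omega)) B).tgt) ∧
                ∀ ν, (B10Eq27TorusAxialLog.rel z ℓ'.src ν).natAbs ≤ 2
              then logVec (su2Quat (descendTo F ℰp (J + (t + 1)) K (by omega) (fun ℓ => expPoint (ζ ℓ) * U₀ ℓ : GaugeField (F.P K) 0 (Matrix.specialUnitaryGroup (Fin 2) ℂ)) ℓ' * (descendTo F ℰp (J + (t + 1)) K (by omega) U₀ ℓ')⁻¹)) else 0)‖ ^ 2) := by ring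
    rw [e2] at hB
    linarith
  -- sum over the levels
  have hS := Finset.sum_le_sum hlev
  rw [Finset.sum_add_distrib, ← Finset.mul_sum, ← Finset.mul_sum] at hS
  have hE0 : 0 ≤ E := Real.exp_nonneg _
  have hS'0 : 0 ≤ ∑ t ∈ Finset.range (K - J), EL t := Finset.sum_nonneg fun t htm => by
    have ht : t < K - J := Finset.mem_range.mp htm
    rw [hEL]; simp only [dif_pos ht]
    exact mul_nonneg (pow_nonneg hL0 t) (Finset.sum_nonneg fun _ _ => sq_nonneg _)
  have hc1 : 0 ≤ 2 * (3 * Kc) ^ 2 := by positivity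
  have hmain : (2 * (3 * Kc) ^ 2) * (∑ t ∈ Finset.range (K - J), (F.L : ℝ) ^ t * ∑ B : PBond (F.P J) 0, ρP t B ^ 2) ≤
      (2 * (3 * Kc) ^ 2) * (C_P * E * Pu + β_P * ∑ t ∈ Finset.range (K - J), EL t) := mul_le_mul_of_nonneg_left hP hc1
  calc ∑ t ∈ Finset.range (K - J), (F.L : ℝ) ^ t * ∑ B : PBond (F.P J) 0,
          (3 * (Kc * (ρP t B + 2 * a' t * ((ℓ + 2) * (if ht : t < K - J then ‖(fun ℓ' : PBond (F.P (J + (t + 1))) 0 =>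
        if (∃ ℓ'' : PBond (F.P (J + (t + 1))) 0, (∃ z : Site (F.P (J + (t + 1))) 0,
                (B14.Eq22Determines.blockIter (t + 1) z = (bondShift (F.sitesPerDir_eq (m := F.m) (K := J) (j := 0) (m' := F.m) (K' := J + (t + 1)) (j' := t + 1) (by omega)) B).src ∨ B14.Eq22Determines.blockIter (t + 1) z = (bondShift (F.sitesPerDir_eq (m := F.m) (K := J) (j := 0) (m' := F.m) (K' := J + (t + 1)) (j' := t + 1) (by omega)) B).tgt) ∧
                ∀ ν, (B10Eq27TorusAxialLog.rel z ℓ''.src ν).natAbs ≤ 2) ∧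
                (blockOf ℓ'.src = (blockOf ℓ''.src).unshift ℓ''.dir ∨ blockOf ℓ'.src = blockOf ℓ''.src ∨ blockOf ℓ'.src = (blockOf ℓ''.src).shift ℓ''.dir))
        then logVec (su2Quat (descendTo F ℰp (J + (t + 1)) K (by omega) (fun ℓ => expPoint (ζ ℓ) * U₀ ℓ : GaugeField (F.P K) 0 (Matrix.specialUnitaryGroup (Fin 2) ℂ)) ℓ' * (descendTo F ℰp (J + (t + 1)) K (by omega) U₀ ℓ')⁻¹)) else 0)‖ else 0))))) ^ 2
      ≤ (2 * (3 * Kc) ^ 2) * (∑ t ∈ Finset.range (K - J), (F.L : ℝ) ^ t * ∑ B : PBond (F.P J) 0, ρP t B ^ 2) +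
          (2 * (3 * Kc * (2 * (ℓ + 2) * ā')) ^ 2 * Cadj) * ∑ t ∈ Finset.range (K - J), EL t := hS
    _ ≤ (2 * (3 * Kc) ^ 2) * (C_P * E * Pu + β_P * ∑ t ∈ Finset.range (K - J), EL t) +
          (2 * (3 * Kc * (2 * (ℓ + 2) * ā')) ^ 2 * Cadj) * ∑ t ∈ Finset.range (K - J), EL t := by linarith
    _ = (2 * (3 * Kc) ^ 2 * C_P) * E * Pu + (2 * (3 * Kc) ^ 2 * β_P + 2 * (3 * Kc * (2 * (ℓ + 2) * ā')) ^ 2 * Cadj) *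
          ∑ t ∈ Finset.range (K - J), EL t := by ring

end Summit.QuantumFields.YangMills.Theorems.FluctuationComparisonRegPrIntLS2BetaKappaRatioDeltaColumn
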